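import Literature.Barriers.Parity.SiegelZeroDichotomyPairHLSixSlotEuler
import Literature.Barriers.Parity.SiegelZeroDichotomyPairHLMainTermLocal
import HarnessLib

/-!
# Tao–Teräväinen 2022, §8 (`k = 2`): the six-slot local factor is the truncated `E_p` of the main term

Topic `Literature/Barriers/Parity`, sub-namespace `TaoTeravainen`; a bridge inside the proof DAG of
`Literature.Barriers.Parity.TaoTeravainen2021_prop72_81_pair` (T. Tao, J. Teräväinen, *The
Hardy–Littlewood–Chowla conjecture in the presence of a Siegel zero*, J. London Math. Soc. (2) 106 (2022),
arXiv:2109.06291), §8 (8.17)–(8.19): the local factor `sixLocalFactor` of the kernel of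
`SiegelZeroDichotomyPairHLSixSlotEuler.lean` (a sum over the local exponent patterns
`(a_j, ε_j, ε'_j)_{j=0,1}`) equals the truncated factor `MainTerm.localE p v_H A χ(p) u v₁ v₂` of
`SiegelZeroDichotomyPairHLMainTermLocal.lean` (a sum over the combined valuations `(A, B)` with the
coefficients `c_{p^A}`), at `u_j = p^{s_{j,0}}`, `v_{1,j} = p^{s_{j,1}}`, `v_{2,j} = p^{s_{j,2}}`
("`E_p = ∑_{d₁,d₂ ∈ ℕ_(p)} ∏ 1_{(d_i,d_j)∣h_i−h_j}/[d₁,d₂] ∏_j c_{d_j,t}`, `c_{d,t} = ∑_{[d₀,d₁,d₂]=d} χ(d₀)μ(d₁)μ(d₂)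
d₀^{-s₀} d₁^{-s₁} d₂^{-s₂}`"). Everything here is PROVED:

* `tripleBox A = range(A+1) × range 2 × range 2`, `tripleMax`, `sideTerm` and `sum_sideTerm_filter_eq_slotC`
  — grouping the patterns of one side by their maximum gives `c_{p^{A'}}`;
* **`sixLocalFactor_eq_localE`** (`χ` quadratic). [cite: TaoTeravainen2021, §8 (8.17)–(8.19)]
-/

noncomputable section

open Finset Real Complex

namespace Literature.Barriers.Parity

namespace TaoTeravainen

variable {q : ℕ}

/-! ### One side: patterns `(a, ε, ε')` grouped by their maximum -/

/-- The local patterns of one side: `a ≤ A`, `ε, ε' ≤ 1`. [cite: TaoTeravainen2021, §8 (8.18)] -/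
def tripleBox (A : ℕ) : Finset (ℕ × ℕ × ℕ) := range (A + 1) ×ˢ (range 2 ×ˢ range 2)

/-- The combined valuation `max(a, ε, ε')` of a pattern. [folklore] -/
def tripleMax (t : ℕ × ℕ × ℕ) : ℕ := max t.1 (max t.2.1 t.2.2)

/-- The weight of a pattern on one side: `χ(p)^a μ(p^ε) μ(p^{ε'}) u^a v₁^ε v₂^{ε'}`.
[cite: TaoTeravainen2021, §8 (8.18)] -/
def sideTerm (χp : ℂ) (u v₁ v₂ : ℂ) (t : ℕ × ℕ × ℕ) : ℂ :=
  χp ^ t.1 * moebiusPow t.2.1 * moebiusPow t.2.2 * (u ^ t.1 * v₁ ^ t.2.1 * v₂ ^ t.2.2)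

/-- `μ(p^0) = 1`. [folklore] -/
@[simp] theorem moebiusPow_zero : moebiusPow 0 = 1 := by simp [moebiusPow]

/-- `μ(p) = -1`. [folklore] -/
@[simp] theorem moebiusPow_one : moebiusPow 1 = -1 := by simp [moebiusPow]

/-- **Grouping one side by the maximum gives `c_{p^{A'}}`**: for `A' ≤ A`,
`∑_{t ∈ tripleBox A, max t = A'} sideTerm t = slotC χ(p) u v₁ v₂ A'` (with real `χ(p)`).
[cite: TaoTeravainen2021, §8 (8.18) and the displays before (8.22)] -/
theorem sum_sideTerm_filter_eq_slotC (χp : ℝ) (u v₁ v₂ : ℂ) {A A' : ℕ} (hA' : A' ≤ A) :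
    ∑ t ∈ (tripleBox A).filter (fun t => tripleMax t = A'), sideTerm (χp : ℂ) u v₁ v₂ t =
      MainTerm.slotC χp u v₁ v₂ A' := by
  -- write the filtered sum as a triple sum of `ite`s and evaluate the `ε, ε'` sums
  rw [sum_filter]
  unfold tripleBox
  rw [sum_product]
  simp_rw [sum_product]
  have hr2 : (range 2 : Finset ℕ) = {0, 1} := by decide
  simp only [hr2, sum_pair (show (0 : ℕ) ≠ 1 by decide), tripleMax, sideTerm]
  simp only [Nat.max_self, max_eq_right (zero_le_one' ℕ), max_eq_left (zero_le_one' ℕ), Nat.max_zero,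
    pow_zero, pow_one, moebiusPow_zero, moebiusPow_one, mul_one]
  -- now a sum over `a ∈ range (A+1)` of four `ite` terms with conditions `a = A'` / `max a 1 = A'`
  rcases Nat.lt_or_ge A' 2 with hA'2 | hA'2
  · interval_cases A'
    · -- `A' = 0`: only `a = 0`, `(ε,ε') = (0,0)`
      rw [MainTerm.slotC_zero, sum_eq_single 0]
      · simp
      · intro a _ ha
        have h2 : max a 1 ≠ 0 := by
          rcases Nat.lt_or_ge a 1 with h | h
          · rw [max_eq_right h.le]; decide
          · rw [max_eq_left h]; exact ha
        simp [h2, ha]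
      · intro h; simp at h
    · -- `A' = 1`
      rw [MainTerm.slotC_one]
      have hsub : ({0, 1} : Finset ℕ) ⊆ range (A + 1) := by
        intro a ha; simp only [mem_insert, mem_singleton] at ha; rw [mem_range]; omega
      rw [← sum_subset hsub]
      · rw [sum_pair (show (0 : ℕ) ≠ 1 by decide)]
        have h01 : max 0 1 = 1 := by decide
        have h11 : max 1 1 = 1 := by decide
        simp only [h01, h11, if_true, show ((0 : ℕ) = 1) = False by decide, if_false, pow_zero, pow_one, one_mul,
          mul_one, zero_add]
        unfold MainTerm.cCoeff
        ring
      · intro a ha hane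
        simp only [mem_insert, mem_singleton, not_or] at hane
        have h2 : max a 1 ≠ 1 := by rw [max_eq_left (by omega)]; omega
        simp [h2, hane.2]
  · -- `A' ≥ 2`: only `a = A'`
    rw [MainTerm.slotC_of_two_le _ _ _ _ hA'2, sum_eq_single A']
    · have h1 : max A' 1 = A' := max_eq_left (by omega)
      simp only [h1, if_true]
      ring
    · intro a _ hane
      have h2 : max a 1 ≠ A' := by
        rcases Nat.lt_or_ge a 1 with ha | ha
        · rw [max_eq_right ha.le]; omega
        · rw [max_eq_left ha]; exact hane
      simp [h2, hane]
    · intro h; rw [mem_range] at h; omega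

/-! ### The bridge -/

/-- `tripleMax t ≤ A` on `tripleBox A` (`A ≥ 1`). [folklore] -/
theorem tripleMax_mem_range {A : ℕ} (hA : 1 ≤ A) {t : ℕ × ℕ × ℕ} (ht : t ∈ tripleBox A) :
    tripleMax t ∈ range (A + 1) := by
  unfold tripleBox at ht
  rw [mem_product, mem_product, mem_range, mem_range, mem_range] at ht
  rw [mem_range]
  unfold tripleMax
  omega

/-- **The six-slot local factor is the main term's truncated `E_p`** (`χ` quadratic): with
`u_j = p^{s_{j,0}(τ_{j,0})}`, `v_{1,j} = p^{s_{j,1}(τ_{j,1})}`, `v_{2,j} = p^{s_{j,2}(τ_{j,2})}`,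
`sixLocalFactor χ X R h₁ h₂ p A τ = MainTerm.localE p v_p(h₁−h₂) A χ(p) u v₁ v₂` (`A ≥ 1`).
[cite: TaoTeravainen2021, §8 (8.17)–(8.19)] -/
theorem sixLocalFactor_eq_localE (χ : DirichletCharacter ℂ q) (hχ : χ.IsQuadratic) (X R : ℝ) (h₁ h₂ p : ℕ) {A : ℕ}
    (hA : 1 ≤ A) (τ : Slot → ℝ) :
    sixLocalFactor χ X R h₁ h₂ p A τ =
      MainTerm.localE p ((shiftDiff h₁ h₂).factorization p) A (realChar χ p)
        (fun j => npow (slotExpo X R (j, 0) (τ (j, 0))) p)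
        (fun j => npow (slotExpo X R (j, 1) (τ (j, 1))) p)
        (fun j => npow (slotExpo X R (j, 2) (τ (j, 2))) p) := by
  set vH := (shiftDiff h₁ h₂).factorization p with hvH
  set χp : ℝ := realChar χ p with hχp
  set u : Fin 2 → ℂ := fun j => npow (slotExpo X R (j, 0) (τ (j, 0))) p with hu
  set v₁ : Fin 2 → ℂ := fun j => npow (slotExpo X R (j, 1) (τ (j, 1))) p with hv₁
  set v₂ : Fin 2 → ℂ := fun j => npow (slotExpo X R (j, 2) (τ (j, 2))) p with hv₂
  have hχc : χ ((p : ℕ) : ZMod q) = (χp : ℂ) := by rw [hχp, realChar_coe χ hχ]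
  -- the density as a function of the two maxima
  set D : ℕ → ℕ → ℂ := fun A' B' => if min A' B' ≤ vH then (((p : ℂ) ^ max A' B')⁻¹) else 0 with hD
  -- Step 1: the summand at a pattern, in product form over the two sides
  have hsummand : ∀ lam : Slot → ℕ,
      ((localDens p vH lam : ℝ) : ℂ) * locArith χ p lam * ∏ k : Slot, npow (slotExpo X R k (τ k)) p ^ lam k =
      D (tripleMax (slotTriple lam 0)) (tripleMax (slotTriple lam 1)) *
        (sideTerm (χp : ℂ) (u 0) (v₁ 0) (v₂ 0) (slotTriple lam 0) * sideTerm (χp : ℂ) (u 1) (v₁ 1) (v₂ 1) (slotTriple lam 1)) := by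
    intro lam
    have hdens : ((localDens p vH lam : ℝ) : ℂ) = D (tripleMax (slotTriple lam 0)) (tripleMax (slotTriple lam 1)) := by
      simp only [localDens, hD, tripleMax, slotTriple]
      split_ifs <;> push_cast <;> rfl
    rw [hdens, Fintype.prod_prod_type, Fin.prod_univ_two, Fin.prod_univ_three, Fin.prod_univ_three]
    unfold locArith
    rw [Fin.prod_univ_two]
    simp only [sideTerm, slotTriple, hχc, hu, hv₁, hv₂]
    ring
  unfold sixLocalFactor MainTerm.localE
  rw [sum_congr rfl fun lam _ => hsummand lam]
  -- Step 2: reindex the patterns by pairs of triples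
  have hreindex : ∑ lam ∈ locBox A, D (tripleMax (slotTriple lam 0)) (tripleMax (slotTriple lam 1)) *
      (sideTerm (χp : ℂ) (u 0) (v₁ 0) (v₂ 0) (slotTriple lam 0) * sideTerm (χp : ℂ) (u 1) (v₁ 1) (v₂ 1) (slotTriple lam 1)) =
      ∑ tt ∈ tripleBox A ×ˢ tripleBox A, D (tripleMax tt.1) (tripleMax tt.2) *
        (sideTerm (χp : ℂ) (u 0) (v₁ 0) (v₂ 0) tt.1 * sideTerm (χp : ℂ) (u 1) (v₁ 1) (v₂ 1) tt.2) := by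
    refine sum_equiv slotEquiv (fun lam => ?_) (fun lam _ => rfl)
    unfold locBox tripleBox
    rw [Fintype.mem_piFinset, mem_product, mem_product, mem_product, mem_product, mem_product]
    simp only [slotEquiv, Equiv.coe_fn_mk, slotTriple, locRange]
    constructor
    · intro h
      have h00 := h (0, 0); have h01 := h (0, 1); have h02 := h (0, 2)
      have h10 := h (1, 0); have h11 := h (1, 1); have h12 := h (1, 2)
      simp only [Fin.isValue, if_true, show ((1 : Fin 3) = 0) = False by decide,
        show ((2 : Fin 3) = 0) = False by decide, if_false] at h00 h01 h02 h10 h11 h12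
      exact ⟨⟨h00, h01, h02⟩, h10, h11, h12⟩
    · rintro ⟨⟨h00, h01, h02⟩, h10, h11, h12⟩ ⟨j, i⟩
      fin_cases j <;> fin_cases i <;> simp [h00, h01, h02, h10, h11, h12]
  rw [hreindex, sum_product]
  -- Step 3: group each side by its maximum
  rw [← sum_fiberwise_of_maps_to (s := tripleBox A) (t := range (A + 1)) (g := tripleMax) fun t ht => tripleMax_mem_range hA ht]
  refine sum_congr rfl fun A' hA' => ?_
  rw [mem_range] at hA'
  have hinner : ∀ t₀ ∈ (tripleBox A).filter (fun t => tripleMax t = A'),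
      ∑ t₁ ∈ tripleBox A, D (tripleMax t₀) (tripleMax t₁) *
        (sideTerm (χp : ℂ) (u 0) (v₁ 0) (v₂ 0) t₀ * sideTerm (χp : ℂ) (u 1) (v₁ 1) (v₂ 1) t₁) =
      sideTerm (χp : ℂ) (u 0) (v₁ 0) (v₂ 0) t₀ *
        ∑ B' ∈ range (A + 1), D A' B' * ∑ t₁ ∈ (tripleBox A).filter (fun t => tripleMax t = B'),
          sideTerm (χp : ℂ) (u 1) (v₁ 1) (v₂ 1) t₁ := by
    intro t₀ ht₀
    rw [mem_filter] at ht₀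
    rw [ht₀.2, mul_sum,
      ← sum_fiberwise_of_maps_to (s := tripleBox A) (t := range (A + 1)) (g := tripleMax) fun t ht => tripleMax_mem_range hA ht]
    refine sum_congr rfl fun B' _ => ?_
    rw [mul_sum, mul_sum]
    refine sum_congr rfl fun t₁ ht₁ => ?_
    rw [mem_filter] at ht₁
    rw [ht₁.2]; ring
  rw [sum_congr rfl hinner, ← sum_mul, sum_sideTerm_filter_eq_slotC χp (u 0) (v₁ 0) (v₂ 0) (by omega), mul_sum]
  refine sum_congr rfl fun B' hB' => ?_
  rw [mem_range] at hB'
  rw [sum_sideTerm_filter_eq_slotC χp (u 1) (v₁ 1) (v₂ 1) (by omega)]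
  simp only [hD]
  split_ifs <;> ring

end TaoTeravainen

end Literature.Barriers.Parity
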